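import Mathlib
import HarnessLib
import HarnessLib.Audit
import Summits.CriticalPhenomena.Statement

/-!
Route: PercTruncatedSusceptibility

It suffices to show X_C = H ∧ L [the truncated susceptibility separates 'critical' from
'percolating']:
 H: χ^f(p_c) = Σ_{x∈ℤ³} τ^f_{p_c}(0,x) = ∞, where τ^f_p(0,x) = P_p(0 ↔ x, |C(0)| < ∞) is the
truncated (finite-cluster)
    connectivity — the finite clusters at p_c have infinite mean size EVEN IF an infinite cluster
were present;
 L: for every p with θ(p) > 0, χ^f(p) < ∞ (finite clusters of a percolating phase have summable
connectivities — known for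
    p > p_c, Grimmett1999 Thm (8.18)+(8.21) and (8.51), via slab technology; the content is the
hypothetical point p = p_c).
Assembly: if θ(p_c) > 0 then L gives χ^f(p_c) < ∞, contradicting H. So H → L →
PercolationContinuityZ3 (two lines).

Lean (H): ¬ Summable fun x : Literature.Probability.LatticeModels.Site 3 =>
(Literature.Probability.Percolation.bondPercolation (Literature.Probability.LatticeModels.zdGraph 3)
(Literature.Probability.Percolation.criticalProbI 3)).real
(Literature.Probability.Percolation.openConn 0 x \ Literature.Probability.Percolation.percolatesAt
0)
Lean (L): ∀ p : unitInterval, 0 < Literature.Probability.Percolation.theta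
(Literature.Probability.LatticeModels.zdGraph 3) 0 p → Summable fun x :
Literature.Probability.LatticeModels.Site 3 => (Literature.Probability.Percolation.bondPercolation
(Literature.Probability.LatticeModels.zdGraph 3) p).real
(Literature.Probability.Percolation.openConn 0 x \ Literature.Probability.Percolation.percolatesAt
0)

Rationale: WHY THIS LINE. A first-order percolation transition is not absurd in general: in the one-dimensional
1/r² model θ IS
discontinuous at p_c (AizenmanNewman1986; Grimmett1999 Thm (12.8), p.369), and the mechanism there
is read off the finite
clusters / truncated functions. This route splits θ(p_c) = 0 on ℤ³ into two statements about FINITE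
clusters only, one
'critical' (H) and one 'supercritical' (L), so that two different toolboxes apply and neither
statement mentions the value of
θ(p_c): H is a target for differential-inequality / ghost-field methods that see finite clusters
through M(p,h) and ∂M/∂h
(AizenmanBarskyFernandez1987-type, Menshikov; Newman1986 doi:10.1007/bf01021076 — critical-exponent
inequalities under a
discontinuity hypothesis, NOT YET READ here: acq-00047; Hutchcroft2020 doi:10.2140/pmp.2020.1.147
for the modern OSSS-based
versions), L is a target for supercritical coarse-graining at a percolating parameter
(ChayesChayesNewman1987
doi:10.1214/aop/1176991976, whose proof of σ(p) > 0 needs only 'some slab percolates at p',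
Grimmett1999 pp.210–212). Area
imported: the long-range/mean-field discontinuity theory (AizenmanNewman1986,
Aizenman–Chayes–Chayes–Newman 1988) as a
dictionary 'discontinuity ⇔ anomalous finite-cluster statistics', and critical-exponent-inequality
technology.
In the real world (θ(p_c) = 0) H is the theorem χ(p_c) = ∞ (sharpness + lower semicontinuity of χ)
and L is Grimmett1999
(8.51); the difficulty of each is entirely in the counterfactual case, which is why they are cruxes
and not facts.

RANKED CRUXES.
 r2 CritTruncatedSusceptibilityInfinite = H (rank 2, most informative: no existing technique
controls finite clusters at p_c
    without knowing θ(p_c); a proof would likely give the mean-field bound χ^f(p) ≥ c/|p − p_c| from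
above as well).
 r3 TruncatedSusceptibilityFiniteOfTheta = L (rank 3; reduces to PercHalfSpace.r2 'slab percolation
at p' by CCN, but other
    proofs — e.g. via uniqueness + polynomial-growth coarse graining, Contreras–Martineau–Tassion
2022 style — are welcome).
 r4 FiniteRadiusExpDecayOfTheta (rank 4): the radius form σ(p) > 0 at every percolating p: P_p(0 ↔
∂B(n), |C| < ∞) ≤ e^{−cn}
    (Grimmett1999 Thm (8.21) for p > p_c); implies L.
 support (rank 9): TruncatedSusceptibilityFiniteSupercrit (L for p > p_c: citation, Grimmett1999
(8.51)).
 Assembly (rank 1): H → L → PercolationContinuityZ3.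

KILL CRITERIA. ¬H (χ^f(p_c) < ∞) together with the known χ(p_c) = ∞ would PROVE θ(p_c) > 0, i.e.
refute the conjunct — so a
refutation of H is a refutation of CriticalPhenomena; realistic kills are: (i) Newman1986, once
read, shows H is equivalent to
something already filed (then merge into PercOpenSupercrit); (ii) a proof that L at p = p_c is
equivalent to slab percolation at
p_c (then this route is dominated by PercHalfSpace and should close).

NOT DECOMPOSED: the ghost-field formulation of H (M(p_c,h) − θ(p_c) ≫ h); volume vs radius tails;
which differential
inequality; site version.

Novelty: NOVELTY (D-0021; searches run 2026-08-14: lit search local+crossref/zbmath, lit --hybrid, lit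
vsearch, lit frontier/bridges CriticalPhenomena, lit galaxy pdf/crabby/intelligent; reads quoted by
PDF page).
Nearest prior art FOUND:
(1) Sufficient conditions for θ(p_c)=0 phrased through finite-cluster / susceptibility data — all
from BELOW p_c: AizenmanKestenNewman1987 (doi:10.1007/bf01219071) §1 Remark p.509 ("there exist some
sufficient conditions for continuity of P∞ at the critical point [AB2; N2]": the triangle condition,
and "any a priori bound which would force τ(x,y) to become small … uniformly in β<β_c"); Newman1986
(doi:10.1007/bf01021076, paywalled, acq-00047, unread here; per AKN87 p.523 "γ<2 … cannot be valid
unless P∞(p_c)=0 [N1;N2]"); HermonHutchcroft2021 (arXiv:1809.11112) Thm 1.3 (uniform-in-p<p_c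
cluster-volume bounds bootstrapped via the two-ghost inequality, then "the same bound must hold at
p_c by an elementary continuity argument", p.5) — void on ℤ³ (polynomial growth).
(2) The discontinuity theory of 1-d 1/r² models, which is the dictionary this route imports:
AizenmanNewman1986 (M=0 ∨ βM²≥1; χ diverges from below yet M jumps, Remark (iv)); ImbrieNewman1988
(doi:10.1007/bf01218582) Cor. 1.5 p.314: in the percolating intermediate phase τ'(x,y) ≥ C|x−y|^{−θ}
with θ<1, hence χ'=Σ_x τ'(0,x)=∞ (1.32) — i.e. statement L is FALSE there while θ>0.
(3) Supercritical finite-cluster theory on ℤ^d, valid for p>p_c only because it rests on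
Grimmett–Marstrand sprinkling  [refs: 10.1007/bf01219071, 10.1007/bf01021076, 10.1007/bf01218582, 1809.11112, 1901.10363, doi:10.1007/bf01219071, doi:10.1007/bf01021076, doi:10.1007/bf01218582, Newman1986, HermonHutchcroft2021, AizenmanNewman1986, ChayesChayesNewman1987, Grimmett1999, AizenmanBarsky1987, Hutchcroft2020, Grimmett2006]

Barriers (technique_class: truncated-susceptibility; ghost-field BK; same-p coarse-grain): BARRIERS (catalogue Literature/Barriers/CriticalPhenomena/, decls in namespace
Literature.Barriers.CriticalPhenomena; checked 2026-08-14).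
- LongRangeDiscontinuity (AizenmanNewman1986 Prop 1.1; 1-d 1/r² models jump at p_c): APPLIES and
calibrates the route. In that family θ jumps while χ diverges from below (AN86 Remark (iv)), and in
the percolating intermediate phase the truncated function obeys τ'(x,y) ≥ C|x−y|^{−θ}, θ<1, so χ'=∞
(ImbrieNewman1988, doi:10.1007/bf01218582, Cor. 1.5/(1.32) p.314): statement L is FALSE there. Hence
any proof of L (and r4) must use an input false for 1/r² chains — finite range and d=3 geometry
(surface-order cost of large finite clusters, Grimmett1999 Thm (8.18)/(8.21)-type coarse graining).
H is not blocked by this barrier (conjecturally the H-analogue holds there: IN88 p.304 'we do not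
quite prove … that θ vanishes as β↓β_c', conjecture (1.22) θ=min(2(M²β−1),2) with M²β=1 at β_c, so
τ' would not be summable at β_c). Evasion: L is stated for n.n. ℤ³ only and its known p>p_c proof is
already range/dimension specific; the bet is that a same-p version exists.
- RandomClusterFirstOrder (Grimmett2006 Thm (7.33); LMMRS 1991; q>Q(d)): APPLIES to H and calibrates
the other horn. At p_c(q) the wired state percolates AND its finite clusters are massive: φ¹_Λ(x↔y,
x↮∂Λ) ≤ e^{−aτ(1+|x−y|)} for p ≥ p_c(q) (Grimmett2006 (7.79), proof of Thm (7.33), PDF p.187) — the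
H-analogue is FALSE, the L/r4-analogue TRUE. Hence a proof of H must use q=1-specific input (

sub-problem: PercolationContinuityZ3 · status: open · opened planner-plan-CriticalPhenomena-PercolationContinuityZ3-0 2026-08-13T19:15:51Z · rev 4 · ledger route-CriticalPhenomena-PercTruncatedSusceptibility
GENERATED by the gate from the ledger (D-0016/17). Provers cite these decls: `theorem foo : Summit.CriticalPhenomena.PercolationContinuityZ3.Theses.PercTruncatedSusceptibility.<Decl> := …` in Summits/CriticalPhenomena/PercolationContinuityZ3/Theorems/<Name>.lean.
-/

namespace Summit.CriticalPhenomena.PercolationContinuityZ3.Theses.PercTruncatedSusceptibility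

open scoped BigOperators Topology Manifold Classical MeasureTheory ProbabilityTheory Matrix InnerProductSpace ComplexConjugate ContinuousMap
open Filter Set Function TopologicalSpace MeasureTheory

attribute [summit_statement] _root_.PercolationContinuityZ3

/-- item stmt-CriticalPhenomena-0850 · crux · rank 2 · closed · proved by Summit.CriticalPhenomena.PercolationContinuityZ3.Theorems.PercTruncatedSusceptibilityCritTruncatedSusceptibilityInfinite.critTruncatedSusceptibilityInfinite_proof @ 6aa50cc13111 (prover) · by planner
why it might fail: Fails iff p_c percolates with massive finite clusters (χ^f(p_c)<∞), the ordered side of a first-order point: large-q RC at p_c(q) has θ¹>0 and φ¹(x↔y, x↮∂Λ)≤e^{-aτ(1+|x-y|)} (Grimmett2006 (7.79), proof of Thm 7.33). χ(p)→∞ as p↑p_c (Grimmett1999 (6.52)) does not reach p_c: χ^f is only lsc.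
sources: Grimmett2006, Thm (7.33)(b) and (7.79) in its proof (lit PDF p.187): wired RC at p>=p_c(q), q large, percolates with exponentially decaying truncated connectivity, Grimmett1999, (6.52) p.127 (chi->inf as p up to p_c), Sect. 10.2 p.266 ('chi^f(p_c)=chi(p_c)=inf if theta(p_c)=0'), Sect. 8.5 p.213 (tau at p_c open), AizenmanKestenNewman1987 (doi:10.1007/bf01219071), Sect. 1 Remark p.509 and p.523 (known sufficient conditions for continuity: [AB2] triangle, [N2] gamma<2 - both from below p_c), Newman1986 (doi:10.1007/bf01021076) - unread, paywalled, acq-00047; kill criterion (i) of the rationale, Grimmett1999, Thm (5.48)/Prop (5.49) p.105 (Aizenman-Barsky ghost-field inequalities take chi^f(p)=inf as hypothesis); Hutchcroft2020 (arXiv:1901.10363) (1.3)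
[crux] r2 = H: the truncated susceptibility of bond percolation on Z^3 is infinite AT p_c: Σ_x
P_{p_c}(0 ↔ x, |C(0)| < ∞) = ∞ (not Summable over Site 3; the event is openConn 0 x minus
percolatesAt 0). If θ(p_c) = 0 this is the theorem χ(p_c) = ∞ (χ(p_c) = ∞ is Grimmett1999 (6.52);
mean-field bound γ ≥ 1, Grimmett1999 §10.2 p.279); the content is that finite clusters at p_c are
critical even if an infinite cluster coexisted. Tools: ghost-field differential inequalities
(AizenmanBarskyFernandez1987-type), Newman1986 (doi:10.1007/bf01021076, to be read: acq-00047),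
Hutchcroft2020. -/
@[route_item "route-CriticalPhenomena-PercTruncatedSusceptibility"]
def CritTruncatedSusceptibilityInfinite : Prop :=
  ¬ Summable fun x : Literature.Probability.LatticeModels.Site 3 => (Literature.Probability.Percolation.bondPercolation (Literature.Probability.LatticeModels.zdGraph 3) (Literature.Probability.Percolation.criticalProbI 3)).real (Literature.Probability.Percolation.openConn 0 x \ Literature.Probability.Percolation.percolatesAt 0)

/-- item stmt-CriticalPhenomena-0852 · crux · rank 3 · closed · proved by Summit.CriticalPhenomena.PercolationContinuityZ3.Theorems.PercNecklaceBackboneTruncatedSusceptibilityFiniteOfTheta.truncatedSusceptibilityFiniteOfTheta_proof @ 9027a12a25f1 (prover) · by planner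
why it might fail: θ(p)>0 ⇏ χ^f(p)<∞ in general: 1-d 1/r² percolation has M>0 with χ'=Στ'=∞ (ImbrieNewman1988 Cor 1.5: τ'≥C|x|^-θ, θ<1). On Z³ the only engine (Grimmett1999 Thm 8.21→(8.51), CCN87) needs a slab percolating at p; at p=p_c none does (DST2016 Thm 1, p_c(S_k)≥p_c): the live case has no tool.
sources: ImbrieNewman1988 (doi:10.1007/bf01218582, held: paper:doi-10-1007-bf01218582), Cor. 1.5 and (1.31)-(1.32) p.314, Grimmett1999, Thm (8.21) and its proof p.210 ('since p>p_c we may by Theorem (7.2) choose k such that p>p_c(R_k)'), (8.51) p.213, DuminilCopinSidoraviciusTassion2016 (arXiv:1401.7130), Thm 1; Literature.Probability.Percolation.DuminilCopinSidoraviciusTassion2016, Literature.Barriers.CriticalPhenomena.SprinklingRenormalisation; Literature.Barriers.CriticalPhenomena.LongRangeDiscontinuity, ChayesChayesNewman1987 (doi:10.1214/aop/1176991976); GrimmettMarstrand1990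
[crux] r3 = L: at every p with θ(p) > 0 the truncated connectivity of bond percolation on Z^3 is
summable: Σ_x P_p(0 ↔ x, |C(0)| < ∞) < ∞. Known for p > p_c: Grimmett1999 Thm (8.18) with (8.21)
(σ(p) > 0, proof of ChayesChayesNewman1987 using a percolating slab at p, pp.210–212) and (8.51)
τ^f_p(0,x) ≤ A‖x‖^d e^{−σ‖x‖}. The live case is a hypothetical percolating p_c ("no sprinkling"). -/
@[route_item "route-CriticalPhenomena-PercTruncatedSusceptibility"]
def TruncatedSusceptibilityFiniteOfTheta : Prop :=
  ∀ p : unitInterval, 0 < Literature.Probability.Percolation.theta (Literature.Probability.LatticeModels.zdGraph 3) 0 p → Summable fun x : Literature.Probability.LatticeModels.Site 3 => (Literature.Probability.Percolation.bondPercolation (Literature.Probability.LatticeModels.zdGraph 3) p).real (Literature.Probability.Percolation.openConn 0 x \ Literature.Probability.Percolation.percolatesAt 0)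

/-- item stmt-CriticalPhenomena-0853 · crux · rank 4 · closed · proved by Summit.CriticalPhenomena.PercolationContinuityZ3.Theorems.PercTruncatedSusceptibilityFiniteRadiusExpDecayOfTheta.finiteRadiusExpDecayOfTheta_proof @ 860646e4bf35 (prover) · by planner
why it might fail: Stronger than L: finite finite-cluster correlation length AT a percolating p_c though ξ(p)→∞ as p↑p_c. Exp. decay comes from sprinkled blocks, p>p_c only (Grimmett1999 (8.21) via (7.2), η>0 vital p.162); no same-p block step from θ(p)>0 alone (Cerf2015 p.4). May fail with L true (summable power law)
sources: Grimmett1999, Thm (8.18) p.205, Thm (8.21) p.205 with proof pp.210-212, Sect. 7.3 p.162 (eta>0 'vital'), Literature.Barriers.CriticalPhenomena.SprinklingRenormalisation (Grimmett1999 Thm (7.2)(a); GrimmettMarstrand1990), Cerf2015 (arXiv:1306.3105), Thm 1.3 and p.4 ('the missing ingredient is a suitable construction ... starting solely with the hypothesis that theta(p)>0'), ImbrieNewman1988 (doi:10.1007/bf01218582) Cor. 1.5 (power-law truncated connectivity in a percolating phase), DuminilCopinSidoraviciusTassion2016 (arXiv:1401.7130), Thm 1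
[crux] r4 (stronger radius form of L): at every p with θ(p) > 0 there is c > 0 with P_p(0 ↔ ∂B(n)
inside B(n), |C(0)| < ∞) ≤ exp(−c n) for all n (event siteToBoundary 3 n minus percolatesAt 0). This
is σ(p) > 0 of Grimmett1999 Thm (8.21) (there for p > p_c, constant absorbed using P ≤ 1 − θ(p) < 1
for small n). Implies L since τ^f_p(0,x) ≤ P_p(0 ↔ ∂B(‖x‖), |C| < ∞). -/
@[route_item "route-CriticalPhenomena-PercTruncatedSusceptibility"]
def FiniteRadiusExpDecayOfTheta : Prop :=
  ∀ p : unitInterval, 0 < Literature.Probability.Percolation.theta (Literature.Probability.LatticeModels.zdGraph 3) 0 p → ∃ c : ℝ, 0 < c ∧ ∀ n : ℕ, (Literature.Probability.Percolation.bondPercolation (Literature.Probability.LatticeModels.zdGraph 3) p).real (Literature.Probability.Percolation.siteToBoundary 3 n \ Literature.Probability.Percolation.percolatesAt 0) ≤ Real.exp (-c * n)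

/-- item stmt-CriticalPhenomena-0854 · support · rank 9 · closed · proved by Summit.CriticalPhenomena.PercolationContinuityZ3.Theorems.TruncatedSusceptibilityFiniteOfTheta.truncatedSusceptibilityFiniteSupercrit_proof @ c143c7629a8b (prover) · by planner
[support] The known part of L, wanted as a citation: for p > p_c(Z^3), Σ_x P_p(0 ↔ x, |C(0)| < ∞) <
∞. Grimmett1999 (8.51) with Thm (8.21) (σ(p) > 0 for p > p_c, d ≥ 3; ChayesChayesNewman1987;
Chayes–Chayes–Grimmett–Kesten–Schonmann 1989). Expected to close by a Literature named fact. -/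
@[route_item "route-CriticalPhenomena-PercTruncatedSusceptibility"]
def TruncatedSusceptibilityFiniteSupercrit : Prop :=
  ∀ p : unitInterval, Literature.Probability.Percolation.criticalProb (Literature.Probability.LatticeModels.zdGraph 3) 0 < (p : ℝ) → Summable fun x : Literature.Probability.LatticeModels.Site 3 => (Literature.Probability.Percolation.bondPercolation (Literature.Probability.LatticeModels.zdGraph 3) p).real (Literature.Probability.Percolation.openConn 0 x \ Literature.Probability.Percolation.percolatesAt 0)

/-- item stmt-CriticalPhenomena-0851 · assembly · rank 1 · closed · proved by Summit.CriticalPhenomena.PercolationContinuityZ3.Theorems.PercTruncatedSusceptibilityAssembly.assembly_proof @ f310d1ecd244 (prover) · by planner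
[assembly] H → L → PercolationContinuityZ3: if θ(p_c) ≠ 0 then θ(p_c) > 0 (measureReal_nonneg), L at
p = criticalProbI 3 gives Summable, contradicting H. Two lines. -/
@[route_item "route-CriticalPhenomena-PercTruncatedSusceptibility"]
def Assembly : Prop :=
  (¬ Summable fun x : Literature.Probability.LatticeModels.Site 3 => (Literature.Probability.Percolation.bondPercolation (Literature.Probability.LatticeModels.zdGraph 3) (Literature.Probability.Percolation.criticalProbI 3)).real (Literature.Probability.Percolation.openConn 0 x \ Literature.Probability.Percolation.percolatesAt 0)) → (∀ p : unitInterval, 0 < Literature.Probability.Percolation.theta (Literature.Probability.LatticeModels.zdGraph 3) 0 p → Summable fun x : Literature.Probability.LatticeModels.Site 3 => (Literature.Probability.Percolation.bondPercolation (Literature.Probability.LatticeModels.zdGraph 3) p).real (Literature.Probability.Percolation.openConn 0 x \ Literature.Probability.Percolation.percolatesAt 0)) → PercolationContinuityZ3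

/-! D-0027 §2.1 — DECIDING THEOREM (planner-authored via `route open/edit --closes-file`; by planner-rbadge-CriticalPhenomena-PercTruncated-d4b6b46d-g4-0 2026-08-15T16:08:44Z):
its hypotheses are this route's items and its conclusion the sub-problem Statement (glue_lint), and it elaborates with this file. -/

@[closes "route-CriticalPhenomena-PercTruncatedSusceptibility"] theorem closes : CritTruncatedSusceptibilityInfinite → TruncatedSusceptibilityFiniteOfTheta → _root_.PercolationContinuityZ3 := by
  intro hH hL
  show Literature.Probability.Percolation.theta (Literature.Probability.LatticeModels.zdGraph 3) (0 : Literature.Probability.LatticeModels.Site 3) (Literature.Probability.Percolation.criticalProbI 3) = 0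
  by_contra hne
  exact hH (hL (Literature.Probability.Percolation.criticalProbI 3) (lt_of_le_of_ne MeasureTheory.measureReal_nonneg (Ne.symm hne)))

end Summit.CriticalPhenomena.PercolationContinuityZ3.Theses.PercTruncatedSusceptibility
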